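import Mathlib

/-!
# `MatrixDescartes` census — DOOR A tool: the THREE-BLOCK CONVEXITY LAW (all sizes `m`, all term counts `K`, all supports)

HONEST FRAMING.  Object-search cell `pub-symmetroid`, door-A seat `val-sym-door-p4` (gen 17); items stmt-ValiantsHypothesis-19979
`DoorA26` / 19980 `DoorA34` (OPEN, typed, never asserted); helper `--supports 19979`, NO closure claim, no definition.  Nothing here
bounds `ζ_sym(2,6)` or `ζ_sym(3,4)`, decides a door, or bears on `MatrixDescartes` (stmt-ValiantsHypothesis-18050) / `VP ≠ VNP`.

THE LAW.  Let `F(x) = ∑ₗ x^{dₗ} Sₗ` be a real symmetric `m × m` lacunary pencil.  Call the RAYLEIGH WORD of a vector `v` the sequence of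
signs of `vᵀSₗv` ordered by the exponents `dₗ`.  Suppose every Rayleigh word is THREE-BLOCK `(+…+)(−…−)(+…+)` — i.e. for every `v`
there are real pivots `e₁ ≤ e₂` (depending on `v`!) with `vᵀSₗv ≥ 0` when `dₗ < e₁` or `dₗ > e₂` and `vᵀSₗv ≤ 0` when `e₁ ≤ dₗ ≤ e₂`.
Then the NEGATIVE-SEMIDEFINITE LOCUS `{x > 0 : F(x) ≼ 0}` and the negative-definite locus `{x > 0 : F(x) ≺ 0}` are CONVEX (intervals):
`threeBlock_nonpos_between`, `threeBlock_neg_between`; hence no det-root lies strictly inside a window with negative definite ends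
(`threeBlock_det_ne_zero_between`).  Mirror (words `(−…−)(+…+)(−…−)`): the PSD / PD loci are intervals (`threeBlock_nonneg_between'`).
The pivots may vary with the direction `v`, so the class is wider than any fixed-gauge Loewner sector; at `m = 2` it says: in such a
sign class the `λ_max`-branch changes sign at most twice (the N-type excursion is a single window) — g16's paper Lemma A for the
surviving `(2,4)` law T3D (memo DOOR-A26-P4G16 §4 (b)), typed for every format.

PROOF (one-variable, elementary).  §1: for a real fewnomial `p(x) = ∑ₗ cₗx^{dₗ}` whose coefficients satisfy `(dₗ − e)·cₗ ≥ 0` (TWO-BLOCK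
word with pivot `e`), `x^{−e}p(x)` is non-decreasing on `(0,∞)` (derivative `x^{−e−1}∑ₗ(dₗ − e)cₗx^{dₗ} ≥ 0`), so positivity of `p`
propagates to the right (`twoBlock_pos_of_pos`).  §2: for a THREE-BLOCK word with pivots `e₁ ≤ e₂` the gauged Euler derivative
`r = ∑ₗ (dₗ − e₁)cₗx^{dₗ}` of `ψ = x^{−e₁}p` is two-block with pivot `e₂`, so `ψ` is non-increasing while `r ≤ 0` and non-decreasing from
the first point where `r > 0` on: `ψ(y) ≤ max (ψ x) (ψ z)` for `x < y < z` (`threeBlock_quasiconvex`), whence `p ≤ 0` (resp. `< 0`) at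
`x` and `z` forces the same at `y`.  §3: intersect over all directions `v`.  [folklore] Mathlib only (`Real.rpow` calculus,
`monotoneOn_of_deriv_nonneg`); axioms standard; no `sorry`, no definitions.
-/

-- the D-0017 layout repeats a namespace component (single-conjunct summit); the `dupNamespace` linter flags it; name mandated.
set_option linter.dupNamespace false

namespace Summit.ValiantsHypothesis.ValiantsHypothesis.Theorems.LacunarySymmetroidMatrixDescartes.Census.ThreeBlock

open Matrix Finset
open scoped BigOperators

/-! ## §1 Two-block words: positivity propagates to the right -/

/-- Derivative of the gauged fewnomial `ψ(y) = ∑ₗ cₗ · y^{dₗ − e}` at `x > 0`: `ψ′(x) = x^{−e−1} · ∑ₗ (dₗ − e)·cₗ·x^{dₗ}`. [folklore] -/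
theorem hasDerivAt_gauged {K : ℕ} (c : Fin K → ℝ) (d : Fin K → ℕ) (e : ℝ) {x : ℝ} (hx : 0 < x) :
    HasDerivAt (fun y : ℝ => ∑ l, c l * y ^ ((d l : ℝ) - e))
      (x ^ (-e - 1) * ∑ l, ((d l : ℝ) - e) * c l * x ^ (d l)) x := by
  have h : HasDerivAt (fun y : ℝ => ∑ l, c l * y ^ ((d l : ℝ) - e))
      (∑ l, c l * (((d l : ℝ) - e) * x ^ ((d l : ℝ) - e - 1))) x := by
    apply HasDerivAt.fun_sum
    intro l _
    exact (Real.hasDerivAt_rpow_const (Or.inl hx.ne')).const_mul (c l)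
  convert h using 1
  rw [Finset.mul_sum]
  refine Finset.sum_congr rfl fun l _ => ?_
  have h1 : x ^ ((d l : ℝ) - e - 1) = x ^ (d l) * x ^ (-e - 1) := by
    rw [show ((d l : ℝ) - e - 1) = (d l : ℝ) + (-e - 1) by ring, Real.rpow_add hx, Real.rpow_natCast]
  rw [h1]; ring

/-- The gauged fewnomial evaluates to `x^{−e}·p(x)`. [folklore] -/
theorem gauged_eq {K : ℕ} (c : Fin K → ℝ) (d : Fin K → ℕ) (e : ℝ) {x : ℝ} (hx : 0 < x) :
    (∑ l, c l * x ^ ((d l : ℝ) - e)) = x ^ (-e) * ∑ l, c l * x ^ (d l) := by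
  rw [Finset.mul_sum]
  refine Finset.sum_congr rfl fun l _ => ?_
  rw [show ((d l : ℝ) - e) = (d l : ℝ) + (-e) by ring, Real.rpow_add hx, Real.rpow_natCast]
  ring

/-- **Two-block monotonicity.**  If `(dₗ − e)·cₗ ≥ 0` for every `l` (coefficients `≤ 0` below the pivot exponent `e`, `≥ 0`
above it), then `x ↦ x^{−e}·∑ₗ cₗx^{dₗ}` is non-decreasing on every window `[α, β] ⊂ (0,∞)`. [folklore] -/
theorem twoBlock_monotoneOn {K : ℕ} (c : Fin K → ℝ) (d : Fin K → ℕ) (e : ℝ)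
    (hc : ∀ l, 0 ≤ ((d l : ℝ) - e) * c l) {α β : ℝ} (hα : 0 < α) :
    MonotoneOn (fun y : ℝ => ∑ l, c l * y ^ ((d l : ℝ) - e)) (Set.Icc α β) := by
  apply monotoneOn_of_deriv_nonneg (convex_Icc α β)
  · intro x hx
    exact (hasDerivAt_gauged c d e (hα.trans_le hx.1)).continuousAt.continuousWithinAt
  · intro x hx
    rw [interior_Icc] at hx
    exact (hasDerivAt_gauged c d e (hα.trans hx.1)).differentiableAt.differentiableWithinAt
  · intro x hx
    rw [interior_Icc] at hx
    rw [(hasDerivAt_gauged c d e (hα.trans hx.1)).deriv]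
    refine mul_nonneg (Real.rpow_pos_of_pos (hα.trans hx.1) _).le (Finset.sum_nonneg fun l _ => ?_)
    exact mul_nonneg (hc l) (pow_nonneg (hα.trans hx.1).le _)

/-- **Two-block words: positivity propagates to the right.**  If `(dₗ − e)·cₗ ≥ 0` for every `l` and `p(x) > 0` at some
`x > 0`, then `p(y) > 0` for every `y ≥ x`. [folklore] -/
theorem twoBlock_pos_of_pos {K : ℕ} (c : Fin K → ℝ) (d : Fin K → ℕ) (e : ℝ)
    (hc : ∀ l, 0 ≤ ((d l : ℝ) - e) * c l) {x y : ℝ} (hx : 0 < x) (hxy : x ≤ y)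
    (hpos : 0 < ∑ l, c l * x ^ (d l)) : 0 < ∑ l, c l * y ^ (d l) := by
  have hy : 0 < y := hx.trans_le hxy
  have hmono := twoBlock_monotoneOn c d e hc (α := x) (β := y) hx
  have h := hmono ⟨le_rfl, hxy⟩ ⟨hxy, le_rfl⟩ hxy
  simp only at h
  rw [gauged_eq c d e hx, gauged_eq c d e hy] at h
  have h1 : 0 < x ^ (-e) * ∑ l, c l * x ^ (d l) := mul_pos (Real.rpow_pos_of_pos hx _) hpos
  have h2 : 0 < y ^ (-e) * ∑ l, c l * y ^ (d l) := h1.trans_le h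
  exact pos_of_mul_pos_right h2 (Real.rpow_pos_of_pos hy _).le

/-! ## §2 Three-block words: quasiconvexity of the gauged fewnomial -/

/-- **Three-block quasiconvexity.**  If the coefficients are `≥ 0` for exponents `< e₁` or `> e₂` and `≤ 0` for exponents in
`[e₁, e₂]`, then `ψ(y) = y^{−e₁}·p(y)` satisfies `ψ(y) ≤ max (ψ x) (ψ z)` for `0 < x ≤ y ≤ z`. [folklore] -/
theorem threeBlock_quasiconvex {K : ℕ} (c : Fin K → ℝ) (d : Fin K → ℕ) {e₁ e₂ : ℝ} (he : e₁ ≤ e₂)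
    (hout : ∀ l, ((d l : ℝ) < e₁ ∨ e₂ < d l) → 0 ≤ c l) (hin : ∀ l, e₁ ≤ d l → (d l : ℝ) ≤ e₂ → c l ≤ 0)
    {x y z : ℝ} (hx : 0 < x) (hxy : x ≤ y) (hyz : y ≤ z) :
    (∑ l, c l * y ^ ((d l : ℝ) - e₁)) ≤ max (∑ l, c l * x ^ ((d l : ℝ) - e₁)) (∑ l, c l * z ^ ((d l : ℝ) - e₁)) := by
  -- the gauged Euler derivative `r = ∑ (dₗ − e₁) cₗ x^{dₗ}` is two-block with pivot `e₂`
  set r : Fin K → ℝ := fun l => ((d l : ℝ) - e₁) * c l with hr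
  have hr2 : ∀ l, 0 ≤ ((d l : ℝ) - e₂) * r l := by
    intro l
    show 0 ≤ ((d l : ℝ) - e₂) * (((d l : ℝ) - e₁) * c l)
    by_cases h1 : (d l : ℝ) < e₁
    · have hc := hout l (Or.inl h1)
      have hA : ((d l : ℝ) - e₁) * c l ≤ 0 := mul_nonpos_of_nonpos_of_nonneg (by linarith) hc
      exact mul_nonneg_of_nonpos_of_nonpos (by linarith) hA
    · push Not at h1
      rcases lt_or_ge e₂ (d l : ℝ) with h2 | h2
      · have hc := hout l (Or.inr h2)
        have hA : 0 ≤ ((d l : ℝ) - e₁) * c l := mul_nonneg (by linarith) hc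
        exact mul_nonneg (by linarith) hA
      · have hc := hin l h1 h2
        have hA : ((d l : ℝ) - e₁) * c l ≤ 0 := mul_nonpos_of_nonneg_of_nonpos (by linarith) hc
        exact mul_nonneg_of_nonpos_of_nonpos (by linarith) hA
  have hy : 0 < y := hx.trans_le hxy
  -- either `r > 0` somewhere in `[x, y]` (then `ψ` is non-decreasing on `[y, z]`) or `r ≤ 0` on `[x, y]`
  by_cases hcase : ∃ t, x ≤ t ∧ t ≤ y ∧ 0 < ∑ l, r l * t ^ (d l)
  · obtain ⟨t, hxt, hty, ht⟩ := hcase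
    have htpos : 0 < t := hx.trans_le hxt
    -- `ψ` non-decreasing on `[y, z]`
    have hmono : MonotoneOn (fun w : ℝ => ∑ l, c l * w ^ ((d l : ℝ) - e₁)) (Set.Icc y z) := by
      apply monotoneOn_of_deriv_nonneg (convex_Icc y z)
      · intro w hw
        exact (hasDerivAt_gauged c d e₁ (hy.trans_le hw.1)).continuousAt.continuousWithinAt
      · intro w hw
        rw [interior_Icc] at hw
        exact (hasDerivAt_gauged c d e₁ (hy.trans hw.1)).differentiableAt.differentiableWithinAt
      · intro w hw
        rw [interior_Icc] at hw
        have hwpos : 0 < w := hy.trans hw.1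
        rw [(hasDerivAt_gauged c d e₁ hwpos).deriv]
        refine mul_nonneg (Real.rpow_pos_of_pos hwpos _).le ?_
        have := twoBlock_pos_of_pos r d e₂ hr2 htpos (hty.trans hw.1.le) ht
        exact this.le
    exact (hmono ⟨le_rfl, hyz⟩ ⟨hyz, le_rfl⟩ hyz).trans (le_max_right _ _)
  · push Not at hcase
    -- `ψ` non-increasing on `[x, y]`
    have hanti : AntitoneOn (fun w : ℝ => ∑ l, c l * w ^ ((d l : ℝ) - e₁)) (Set.Icc x y) := by
      apply antitoneOn_of_deriv_nonpos (convex_Icc x y)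
      · intro w hw
        exact (hasDerivAt_gauged c d e₁ (hx.trans_le hw.1)).continuousAt.continuousWithinAt
      · intro w hw
        rw [interior_Icc] at hw
        exact (hasDerivAt_gauged c d e₁ (hx.trans hw.1)).differentiableAt.differentiableWithinAt
      · intro w hw
        rw [interior_Icc] at hw
        have hwpos : 0 < w := hx.trans hw.1
        rw [(hasDerivAt_gauged c d e₁ hwpos).deriv]
        exact mul_nonpos_of_nonneg_of_nonpos (Real.rpow_pos_of_pos hwpos _).le (hcase w hw.1.le hw.2.le)
    exact (hanti ⟨le_rfl, hxy⟩ ⟨hxy, le_rfl⟩ hxy).trans (le_max_left _ _)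

/-- **Three-block words: non-positivity is convex.**  `p(x) ≤ 0` and `p(z) ≤ 0` with `0 < x ≤ y ≤ z` force `p(y) ≤ 0`. [folklore] -/
theorem threeBlock_nonpos_between {K : ℕ} (c : Fin K → ℝ) (d : Fin K → ℕ) {e₁ e₂ : ℝ} (he : e₁ ≤ e₂)
    (hout : ∀ l, ((d l : ℝ) < e₁ ∨ e₂ < d l) → 0 ≤ c l) (hin : ∀ l, e₁ ≤ d l → (d l : ℝ) ≤ e₂ → c l ≤ 0)
    {x y z : ℝ} (hx : 0 < x) (hxy : x ≤ y) (hyz : y ≤ z)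
    (hpx : ∑ l, c l * x ^ (d l) ≤ 0) (hpz : ∑ l, c l * z ^ (d l) ≤ 0) : ∑ l, c l * y ^ (d l) ≤ 0 := by
  have hy : 0 < y := hx.trans_le hxy
  have hz : 0 < z := hy.trans_le hyz
  have h := threeBlock_quasiconvex c d he hout hin hx hxy hyz
  rw [gauged_eq c d e₁ hx, gauged_eq c d e₁ hy, gauged_eq c d e₁ hz] at h
  have h1 : x ^ (-e₁) * ∑ l, c l * x ^ (d l) ≤ 0 :=
    mul_nonpos_of_nonneg_of_nonpos (Real.rpow_pos_of_pos hx _).le hpx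
  have h2 : z ^ (-e₁) * ∑ l, c l * z ^ (d l) ≤ 0 :=
    mul_nonpos_of_nonneg_of_nonpos (Real.rpow_pos_of_pos hz _).le hpz
  have h3 : y ^ (-e₁) * ∑ l, c l * y ^ (d l) ≤ 0 := h.trans (max_le h1 h2)
  by_contra hcon
  push Not at hcon
  exact absurd h3 (not_le.2 (mul_pos (Real.rpow_pos_of_pos hy _) hcon))

/-- **Three-block words: negativity is convex.**  `p(x) < 0` and `p(z) < 0` with `0 < x ≤ y ≤ z` force `p(y) < 0`. [folklore] -/
theorem threeBlock_neg_between {K : ℕ} (c : Fin K → ℝ) (d : Fin K → ℕ) {e₁ e₂ : ℝ} (he : e₁ ≤ e₂)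
    (hout : ∀ l, ((d l : ℝ) < e₁ ∨ e₂ < d l) → 0 ≤ c l) (hin : ∀ l, e₁ ≤ d l → (d l : ℝ) ≤ e₂ → c l ≤ 0)
    {x y z : ℝ} (hx : 0 < x) (hxy : x ≤ y) (hyz : y ≤ z)
    (hpx : ∑ l, c l * x ^ (d l) < 0) (hpz : ∑ l, c l * z ^ (d l) < 0) : ∑ l, c l * y ^ (d l) < 0 := by
  have hy : 0 < y := hx.trans_le hxy
  have hz : 0 < z := hy.trans_le hyz
  have h := threeBlock_quasiconvex c d he hout hin hx hxy hyz
  rw [gauged_eq c d e₁ hx, gauged_eq c d e₁ hy, gauged_eq c d e₁ hz] at h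
  have h1 : x ^ (-e₁) * ∑ l, c l * x ^ (d l) < 0 := mul_neg_of_pos_of_neg (Real.rpow_pos_of_pos hx _) hpx
  have h2 : z ^ (-e₁) * ∑ l, c l * z ^ (d l) < 0 := mul_neg_of_pos_of_neg (Real.rpow_pos_of_pos hz _) hpz
  have h3 : y ^ (-e₁) * ∑ l, c l * y ^ (d l) < 0 := h.trans_lt (max_lt h1 h2)
  by_contra hcon
  push Not at hcon
  exact absurd h3 (not_lt.2 (mul_nonneg (Real.rpow_pos_of_pos hy _).le hcon))

/-! ## §3 The law for real symmetric lacunary pencils -/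

/-- `vᵀ(∑ₗ x^{dₗ} • Sₗ)v = ∑ₗ (vᵀSₗv)·x^{dₗ}`. [folklore] -/
theorem quadForm_pencil {m K : ℕ} (d : Fin K → ℕ) (S : Fin K → Matrix (Fin m) (Fin m) ℝ) (v : Fin m → ℝ) (x : ℝ) :
    v ⬝ᵥ ((∑ l, x ^ (d l) • S l) *ᵥ v) = ∑ l, (v ⬝ᵥ (S l *ᵥ v)) * x ^ (d l) := by
  rw [Matrix.sum_mulVec, dotProduct_sum]
  refine Finset.sum_congr rfl fun l _ => ?_
  rw [Matrix.smul_mulVec, dotProduct_smul, smul_eq_mul, mul_comm]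

/-- **THREE-BLOCK CONVEXITY LAW (negative semidefinite locus; all `m`, all `K`, all supports).**  If every Rayleigh word of the real
symmetric lacunary pencil `F(x) = ∑ₗ x^{dₗ} • Sₗ` is three-block `(+)(−)(+)` with direction-dependent real pivots, then
`vᵀF(x)v ≤ 0 ∀v` and `vᵀF(z)v ≤ 0 ∀v` with `0 < x ≤ y ≤ z` force `vᵀF(y)v ≤ 0 ∀v`: the locus `{x > 0 : F(x) ≼ 0}` is an interval.
[folklore] -/
theorem threeBlock_nsd_between {m K : ℕ} (d : Fin K → ℕ) (S : Fin K → Matrix (Fin m) (Fin m) ℝ)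
    (hword : ∀ v : Fin m → ℝ, ∃ e₁ e₂ : ℝ, e₁ ≤ e₂ ∧
      (∀ l, ((d l : ℝ) < e₁ ∨ e₂ < d l) → 0 ≤ v ⬝ᵥ (S l *ᵥ v)) ∧
      (∀ l, e₁ ≤ d l → (d l : ℝ) ≤ e₂ → v ⬝ᵥ (S l *ᵥ v) ≤ 0))
    {x y z : ℝ} (hx : 0 < x) (hxy : x ≤ y) (hyz : y ≤ z)
    (hFx : ∀ v, v ⬝ᵥ ((∑ l, x ^ (d l) • S l) *ᵥ v) ≤ 0) (hFz : ∀ v, v ⬝ᵥ ((∑ l, z ^ (d l) • S l) *ᵥ v) ≤ 0) :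
    ∀ v, v ⬝ᵥ ((∑ l, y ^ (d l) • S l) *ᵥ v) ≤ 0 := by
  intro v
  obtain ⟨e₁, e₂, he, hout, hin⟩ := hword v
  have h1 := hFx v
  have h2 := hFz v
  rw [quadForm_pencil] at h1 h2 ⊢
  exact threeBlock_nonpos_between (fun l => v ⬝ᵥ (S l *ᵥ v)) d he hout hin hx hxy hyz h1 h2

/-- **THREE-BLOCK CONVEXITY LAW (negative definite locus).**  Same hypothesis; `vᵀF(x)v < 0` and `vᵀF(z)v < 0` for all `v ≠ 0`
force `vᵀF(y)v < 0` for all `v ≠ 0` (`0 < x ≤ y ≤ z`): the locus `{x > 0 : F(x) ≺ 0}` is an interval. [folklore] -/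
theorem threeBlock_nd_between {m K : ℕ} (d : Fin K → ℕ) (S : Fin K → Matrix (Fin m) (Fin m) ℝ)
    (hword : ∀ v : Fin m → ℝ, ∃ e₁ e₂ : ℝ, e₁ ≤ e₂ ∧
      (∀ l, ((d l : ℝ) < e₁ ∨ e₂ < d l) → 0 ≤ v ⬝ᵥ (S l *ᵥ v)) ∧
      (∀ l, e₁ ≤ d l → (d l : ℝ) ≤ e₂ → v ⬝ᵥ (S l *ᵥ v) ≤ 0))
    {x y z : ℝ} (hx : 0 < x) (hxy : x ≤ y) (hyz : y ≤ z)
    (hFx : ∀ v, v ≠ 0 → v ⬝ᵥ ((∑ l, x ^ (d l) • S l) *ᵥ v) < 0)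
    (hFz : ∀ v, v ≠ 0 → v ⬝ᵥ ((∑ l, z ^ (d l) • S l) *ᵥ v) < 0) :
    ∀ v, v ≠ 0 → v ⬝ᵥ ((∑ l, y ^ (d l) • S l) *ᵥ v) < 0 := by
  intro v hv
  obtain ⟨e₁, e₂, he, hout, hin⟩ := hword v
  have h1 := hFx v hv
  have h2 := hFz v hv
  rw [quadForm_pencil] at h1 h2 ⊢
  exact threeBlock_neg_between (fun l => v ⬝ᵥ (S l *ᵥ v)) d he hout hin hx hxy hyz h1 h2

/-- **No det-root strictly between two negative definite points** (three-block class, every size): if `F(x) ≺ 0` and `F(z) ≺ 0`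
(as quadratic forms) then `det F(y) ≠ 0` for every `y ∈ [x, z]`. [folklore] -/
theorem threeBlock_det_ne_zero_between {m K : ℕ} (d : Fin K → ℕ) (S : Fin K → Matrix (Fin m) (Fin m) ℝ)
    (hword : ∀ v : Fin m → ℝ, ∃ e₁ e₂ : ℝ, e₁ ≤ e₂ ∧
      (∀ l, ((d l : ℝ) < e₁ ∨ e₂ < d l) → 0 ≤ v ⬝ᵥ (S l *ᵥ v)) ∧
      (∀ l, e₁ ≤ d l → (d l : ℝ) ≤ e₂ → v ⬝ᵥ (S l *ᵥ v) ≤ 0))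
    {x y z : ℝ} (hx : 0 < x) (hxy : x ≤ y) (hyz : y ≤ z)
    (hFx : ∀ v, v ≠ 0 → v ⬝ᵥ ((∑ l, x ^ (d l) • S l) *ᵥ v) < 0)
    (hFz : ∀ v, v ≠ 0 → v ⬝ᵥ ((∑ l, z ^ (d l) • S l) *ᵥ v) < 0) :
    (∑ l, y ^ (d l) • S l).det ≠ 0 := by
  intro hdet
  obtain ⟨v, hv, hker⟩ := Matrix.exists_mulVec_eq_zero_iff.2 hdet
  have h := threeBlock_nd_between d S hword hx hxy hyz hFx hFz v hv
  rw [hker, dotProduct_zero] at h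
  exact lt_irrefl 0 h

/-- **Mirror law (positive semidefinite locus).**  If every Rayleigh word is three-block `(−)(+)(−)`, then `{x > 0 : F(x) ≽ 0}` is
an interval: `vᵀF(x)v ≥ 0 ∀v` and `vᵀF(z)v ≥ 0 ∀v` force `vᵀF(y)v ≥ 0 ∀v` for `0 < x ≤ y ≤ z`. [folklore] -/
theorem threeBlock_psd_between {m K : ℕ} (d : Fin K → ℕ) (S : Fin K → Matrix (Fin m) (Fin m) ℝ)
    (hword : ∀ v : Fin m → ℝ, ∃ e₁ e₂ : ℝ, e₁ ≤ e₂ ∧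
      (∀ l, ((d l : ℝ) < e₁ ∨ e₂ < d l) → v ⬝ᵥ (S l *ᵥ v) ≤ 0) ∧
      (∀ l, e₁ ≤ d l → (d l : ℝ) ≤ e₂ → 0 ≤ v ⬝ᵥ (S l *ᵥ v)))
    {x y z : ℝ} (hx : 0 < x) (hxy : x ≤ y) (hyz : y ≤ z)
    (hFx : ∀ v, 0 ≤ v ⬝ᵥ ((∑ l, x ^ (d l) • S l) *ᵥ v)) (hFz : ∀ v, 0 ≤ v ⬝ᵥ ((∑ l, z ^ (d l) • S l) *ᵥ v)) :
    ∀ v, 0 ≤ v ⬝ᵥ ((∑ l, y ^ (d l) • S l) *ᵥ v) := by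
  intro v
  obtain ⟨e₁, e₂, he, hout, hin⟩ := hword v
  have h1 := hFx v
  have h2 := hFz v
  rw [quadForm_pencil] at h1 h2 ⊢
  have h := threeBlock_nonpos_between (fun l => -(v ⬝ᵥ (S l *ᵥ v))) d he
    (fun l hl => neg_nonneg.2 (hout l hl)) (fun l h1' h2' => neg_nonpos.2 (hin l h1' h2')) hx hxy hyz
    (by rw [show (∑ l, -(v ⬝ᵥ (S l *ᵥ v)) * x ^ (d l)) = -∑ l, (v ⬝ᵥ (S l *ᵥ v)) * x ^ (d l) by
          rw [← Finset.sum_neg_distrib]; exact Finset.sum_congr rfl fun l _ => by ring]; linarith)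
    (by rw [show (∑ l, -(v ⬝ᵥ (S l *ᵥ v)) * z ^ (d l)) = -∑ l, (v ⬝ᵥ (S l *ᵥ v)) * z ^ (d l) by
          rw [← Finset.sum_neg_distrib]; exact Finset.sum_congr rfl fun l _ => by ring]; linarith)
  rw [show (∑ l, -(v ⬝ᵥ (S l *ᵥ v)) * y ^ (d l)) = -∑ l, (v ⬝ᵥ (S l *ᵥ v)) * y ^ (d l) by
        rw [← Finset.sum_neg_distrib]; exact Finset.sum_congr rfl fun l _ => by ring] at h
  linarith

end Summit.ValiantsHypothesis.ValiantsHypothesis.Theorems.LacunarySymmetroidMatrixDescartes.Census.ThreeBlock
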